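import Summits.QuantumFields.YangMills.Theorems.BalabanUVNodesN17AtRecord13Keys
import Summits.QuantumFields.YangMills.Theorems.BalabanUVNodesN17AtRateRecord11
import Summits.QuantumFields.YangMills.Theorems.BalabanUVNodesRateCarriersOfRecord13On

/-!
# BalabanUVNodes ∕ node N17 = NE4 AT THE (T-RATE) STAGE-13 RATE-RECORD HOMES `YMDAG.UVSplit.RRec₁₃ 𝔯` (datum-keyed, canonical parameter) AND `RRec₁₃On 𝔯 Rg`
# (regime-restricted, tuple-keyed) — dag-n22-e's layer B at ₁₃ (`…RateCarriersOfRecord13` ∕ `…On`, the sed twins of p466281 ∕ p468431): the K4 stub `S_N17` READ level-free as ONE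
# scale-shift-rate sentence about the canonical-version merged β `βmTχ`, its one-application closers with the in-edges N15 ∕ N16 ∕ N18 ∕ (D4) BY NAME, what it delivers, transfers

Cell `pub-ymgap`, HUMAN RULING D-0062, seat `pub-ymgap-dag-n17-c` (R134 fan-out, strategy s2 = BY-NAME KNIT AT THE RECORD), generation 9; companion 22 (§69–§71) of
`BalabanUVNodesN17Knit` … `…N17AtRecord13Keys` (companion 21).  THEOREMS ONLY (0 `def`); imports companion 21 (N17 at the ₁₃ keys: `N17_iff_betaOfRecord₁₃_params₁₃`,
`n17At_u3Level_iff_params₁₃`, `af0r_params₁₃_of_N17`; hence companion 20's `n17At_datumOfRecord₁₃_iff_merged ∕ N17_datumOfRecord₁₃_iff_betaOfRecord₁₃ ∕ _of_rates ∕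
_of_kernelStepRate ∕ content_of_N17_datumOfRecord₁₃` and RR-2's `Record13DatumKey`), companion 12 `…N17AtRateRecord11` (stage-free `scaleShiftRate_mono_const`), and dag-n22-e's
layer B at Stage 13 `…RateCarriersOfRecord13On` (→ `…RateCarriersOfRecord13`: `RateReading₁₃` — both readings `lit ∕ ne1` TAKE THE ₁₃ PROVISOS —, `u3OfRecord₁₃`, `rateCarriersOfRecord₁₃`,
`RRec₁₃`, `RRec₁₃On`, `s_N17_rRec₁₃_iff`, `s_N17_rRec₁₃On_iff`, `k4_rRec₁₃On_anti`, `k4_rRec₁₃_of_rRec₁₃On_true`, `rRec₁₃On_of_regime_params`); modifies nothing; every cited lemma used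
BY NAME.  Stage-13 twin of companions 16 (p466667, §53–§54) and 19 (p478440, §55–§57) in ONE module (both homes land together at ₁₃), WITH companion 20's two ₁₃ differences: the
datum's β is `betaOfRecord₁₃ θ` (`(TcanOfRecord, χβ₁₃)` assembly; NOT `betaOfRecord₁₀`), every face displayed at `βmTχ(θ) := betaMerged F (mergedTermFamilyMatT F N (TcanOfRecord F N)
(chiβOfRecord₁₃ F N θ) θ.εbg) θ.ρ8 θ.bV`; and the split road in MERGED currency ((AF-0r) for `beta0OfMerged βmTχ(θ) θ.v₀` = N15's, `ScaleShiftRate c₁ ρ θ.γ (βmTχ − β⁰)` = N16 ∕ N18's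
— no printed split of record of the ₁₃ β exists).  §58's faces at the named W1 reading wait for n22-e's `…RateReadingOfRecord13` (separate INTENT there).

THE POINT.  `RRec₁₃ 𝔯 F D g₀ os R :↔ ∃ (h : IsDatumOfRecord₁₃C F N D) k, R = rateCarriersOfRecord₁₃ 𝔯 F h.params h.provisos g₀ os k` and `RRec₁₃On 𝔯 Rg F D g₀ os R :↔ ∃ θ hP, Rg F θ ∧
θ.Admissible F N ∧ D = datumOfRecord₁₃ F N θ hP ∧ ∃ k, R = rateCarriersOfRecord₁₃ 𝔯 F θ hP g₀ os k`.  N17 reads node U3's bundle `u3OfRecord₁₃ θ u k` ONLY through the K-uniform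
letters `(cr·C₅·θ₅, ρ)` and the window radius `θ.γ` (§69 `n17At_u3OfRecord₁₃_iff`, `Iff.rfl`), so `k` drops out and:
* §69 AT `RRec₁₃ 𝔯`: `s_N17_rRec₁₃_iff_merged` (⟺ ∀ datum keys, `g₀, os`: the `βmTχ(h.params)` rate at the reading's letters on `]0, h.params.γ]`) ∕ `_iff_betaOfRecord₁₃`; closers
  `s_N17_rRec₁₃_of_forall_admissible` ∕ `_of_split` ∕ `_of_s_D4_s_N18` (U3 road = `YMDAG.N17.s_N17_of_D4_N18` verbatim) ∕ `_of_readOut_ne5_forall_admissible`; delivery `af0r_of_s_N17_rRec₁₃`.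
* §70 AT `RRec₁₃On 𝔯 Rg` — the stub IS the estimate seats' GUARDED ∀θ currency verbatim: `s_N17_rRec₁₃On_iff_merged` ∕ `_iff_betaOfRecord₁₃` ∕ `_unityNondeg_iff_merged` (RR-2's guard
  of record `unityNondeg₁₃ N`); closers `_of_forall_guarded` ∕ `_of_split` ∕ `_of_s_D4_s_N18` ∕ `_of_readOut_ne5_forall_guarded` ∕ `_of_kernelStepRate_forall_guarded`; delivery
  `af0r_of_s_N17_rRec₁₃On` ((AF-0r) at the tuple + the merged remainder's rate, constants degraded by `1∕(1 − ρ)`).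
* §71 TRANSFERS: `s_N17_rRec₁₃On_anti` · `s_N17_rRec₁₃_of_rRec₁₃On_true` · `s_N17_rRec₁₃On_of_rRec₁₃On_true` · `s_N17_rRec₁₃_of_rRec₁₃On_of_regime_params` ·
  `s_N17_rRec₁₃On_unityNondeg_of_ztUnity` · `s_N17_rRec₁₃On_of_guard_empty` (R422 vacuity face).  NOT CLAIMED: canonical home ⟹ On home.

HONEST FRAMING.  Kernel bookkeeping BY NAME; 0 `sorry`; NE4 NOT IN PRINT ([Balaban1987RG1] (1.20)–(1.22) p. 264) and NOT PROVED; every rate input ((AF-0r), remainder rate, (D4),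
NE5, (UD), step rate) a DISPLAYED hypothesis with no producer at a named reading today; `𝔯` RESIDUAL; no inhabitant of any key claimed (K0‴ `Record13Inhabited`,
stmt-QuantumFields-19909, open) — §71's vacuity face says exactly when the On stubs would be vacuous; N17 = composite (max of N15, N16, (D4)), NOT discharged; counts UNMOVED
(typed 28∕28 · discharged 5∕27, A 5∕28).  One finite four-torus at fixed ε per run — NOT ℝ⁴, NOT infinite volume, NOT OS, NOT a mass gap, NOT Clay.
-/

noncomputable section

open scoped Matrix.Norms.L2Operator

namespace Summit.QuantumFields.YangMills.Theorems.BalabanUVNodesN17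

open Literature.MathematicalPhysics.QuantumFieldTheory.Balaban1983to89
open Literature.MathematicalPhysics.QuantumFieldTheory.Balaban1983to89.FlowStep
open Literature.MathematicalPhysics.QuantumFieldTheory.Balaban1983to89.T4CouplingMatching
open Literature.MathematicalPhysics.QuantumFieldTheory.Balaban1983to89.T4Continuum (T4Family FiniteEpsData ULoop)
open Literature.MathematicalPhysics.QuantumFieldTheory.Balaban1983to89.B12Sec2to5 (Decay510 betaPrime510)
open Literature.MathematicalPhysics.QuantumFieldTheory.Balaban1983to89.Beta.LimitRate (subKernel)
open Literature.MathematicalPhysics.QuantumFieldTheory.Balaban1983to89.Node00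
open Literature.MathematicalPhysics.QuantumFieldTheory.Balaban1983to89.DagBinding (WorldP)
open Summit.QuantumFields.BalabanUV.T4Continuum.Spine.NE4 (NE4OnData ne4OnData_iff)
open YMDAG.UVSplit (Datum U3Carriers RateCarriers RateRecordPred N17At N18At ReadOutAt S_N17 S_N18 S_D4 RateReading₁₃ RRec₁₃ RRec₁₃On u3OfRecord₁₃
  rateCarriersOfRecord₁₃ s_N17_rRec₁₃_iff s_N17_rRec₁₃On_iff k4_rRec₁₃On_anti k4_rRec₁₃_of_rRec₁₃On_true rRec₁₃On_of_regime_params)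

variable {F : T4Family} {N : ℕ} [NeZero N]

/-! ## §69 THE STUB `S_N17 (RRec₁₃ 𝔯)` READ — one scale-shift-rate sentence about `βmTχ(h.params)`, level-free — ITS CLOSERS AND ITS DELIVERY -/

/-- **N17 AT NODE U3's STAGE-13 BUNDLE OF RECORD OF RUN LENGTH `k` DOES NOT READ `k`** (`Iff.rfl`): `N17At D (u3OfRecord₁₃ θ u k) ↔ NE4OnData D (u.cr·u.C₅·u.θ₅) u.ρ θ.γ`.
[cite: Balaban1987RG1, (1.20)-(1.22) p.264] -/
theorem n17At_u3OfRecord₁₃_iff (D : Datum F N) (θ : Stage13Params F N) (u : U3Objects₁₁) (k : ℕ) :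
    N17At D (u3OfRecord₁₃ θ u k) ↔ NE4OnData D (u.cr * u.C₅ * u.θ₅) u.ρ θ.γ := Iff.rfl

/-- **… AT A STAGE-13 DATUM OF RECORD, READ AT ITS CANONICAL PARAMETER**: `N17At D (u3OfRecord₁₃ h.params u k) ↔` the `βmTχ(h.params)` rate on `]0, h.params.γ]` (companion 21
`n17At_u3Level_iff_params₁₃` at `γ := h.params.γ`). [cite: Balaban1987RG1, (1.20)-(1.22) p.264] -/
theorem n17At_u3OfRecord₁₃_iff_params {D : Datum F N} (h : IsDatumOfRecord₁₃C F N D) (u : U3Objects₁₁) (k : ℕ) :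
    N17At D (u3OfRecord₁₃ h.params u k) ↔
      letI := h.params.instVβ₁; letI := h.params.instVβ₂; letI := h.params.instιβ
      ScaleShiftRate (u.cr * u.C₅ * u.θ₅) u.ρ h.params.γ
        (betaMerged F (mergedTermFamilyMatT F N (TcanOfRecord F N) (chiβOfRecord₁₃ F N h.params) h.params.εbg) h.params.ρ8 h.params.bV) :=
  n17At_u3Level_iff_params₁₃ h u le_rfl k

/-- **… AT THE STAGE-13 DATUM OF ANY TUPLE `(θ, hP)`** (the ∀θ currency the estimate seats prove in): `N17At (datumOfRecord₁₃ θ hP) (u3OfRecord₁₃ θ u k) ↔` the `βmTχ(θ)` rate on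
`]0, θ.γ]` (companion 20 `n17At_datumOfRecord₁₃_iff_merged`). [cite: Balaban1987RG1, (1.20)-(1.22) p.264] -/
theorem n17At_u3OfRecord₁₃_datumOfRecord₁₃_iff (θ : Stage13Params F N) (hP : θ.Provisos₁₃ F N) (u : U3Objects₁₁) (k : ℕ) :
    N17At (datumOfRecord₁₃ F N θ hP) (u3OfRecord₁₃ θ u k) ↔
      letI := θ.instVβ₁; letI := θ.instVβ₂; letI := θ.instιβ
      ScaleShiftRate (u.cr * u.C₅ * u.θ₅) u.ρ θ.γ
        (betaMerged F (mergedTermFamilyMatT F N (TcanOfRecord F N) (chiβOfRecord₁₃ F N θ) θ.εbg) θ.ρ8 θ.bV) :=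
  n17At_datumOfRecord₁₃_iff_merged θ hP (u3OfRecord₁₃ θ u k) le_rfl

variable (𝔯 : RateReading₁₃ N) (Rg : (F : T4Family) → Stage13Params F N → Prop)

/-- **THE K4 STUB `S_N17` AT THE STAGE-13 CANONICAL HOME IS ONE SENTENCE ABOUT `βmTχ` OF THE CANONICAL PARAMETER**: `S_N17 (RRec₁₃ 𝔯)` ⟺ for every Stage-13 datum of record `D`
(canonical parameter `h.params`, provisos `h.provisos`), every `g₀, os`: `ScaleShiftRate (cr·C₅·θ₅) ρ h.params.γ βmTχ(h.params)` at the letters of `(𝔯.lit F h.params h.provisos g₀ os).u3`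
— layer B's `s_N17_rRec₁₃_iff` with the run length eliminated (§69 `Iff.rfl`).  NE4 NOT IN PRINT; `𝔯` RESIDUAL. [cite: Balaban1987RG1, (1.20)-(1.22) p.264] -/
theorem s_N17_rRec₁₃_iff_merged :
    S_N17 (RRec₁₃ 𝔯) ↔ ∀ (F : T4Family) (D : Datum F N) (h : IsDatumOfRecord₁₃C F N D) (g₀ : ℕ → ℝ) (os : List (ULoop F)),
      letI := h.params.instVβ₁; letI := h.params.instVβ₂; letI := h.params.instιβ
      ScaleShiftRate
        ((𝔯.lit F h.params h.provisos g₀ os).u3.cr * (𝔯.lit F h.params h.provisos g₀ os).u3.C₅ * (𝔯.lit F h.params h.provisos g₀ os).u3.θ₅)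
        (𝔯.lit F h.params h.provisos g₀ os).u3.ρ h.params.γ
        (betaMerged F (mergedTermFamilyMatT F N (TcanOfRecord F N) (chiβOfRecord₁₃ F N h.params) h.params.εbg) h.params.ρ8 h.params.bV) := by
  rw [s_N17_rRec₁₃_iff]
  constructor
  · intro hS F D h g₀ os
    exact (n17At_u3OfRecord₁₃_iff_params h _ 0).mp (hS F D h g₀ os 0)
  · intro hin F D h g₀ os k
    exact (n17At_u3OfRecord₁₃_iff_params h _ k).mpr (hin F D h g₀ os)

/-- **… OR ABOUT THE β OF RECORD ITSELF** (`betaOfRecord₁₃ h.params = D.βfun`; same window, no box bookkeeping; companion 21 `n17At_iff_betaOfRecord₁₃_params₁₃`).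
[cite: Balaban1987RG1, (1.20)-(1.22) p.264] -/
theorem s_N17_rRec₁₃_iff_betaOfRecord₁₃ :
    S_N17 (RRec₁₃ 𝔯) ↔ ∀ (F : T4Family) (D : Datum F N) (h : IsDatumOfRecord₁₃C F N D) (g₀ : ℕ → ℝ) (os : List (ULoop F)),
      ScaleShiftRate
        ((𝔯.lit F h.params h.provisos g₀ os).u3.cr * (𝔯.lit F h.params h.provisos g₀ os).u3.C₅ * (𝔯.lit F h.params h.provisos g₀ os).u3.θ₅)
        (𝔯.lit F h.params h.provisos g₀ os).u3.ρ h.params.γ (betaOfRecord₁₃ F N h.params) := by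
  rw [s_N17_rRec₁₃_iff]
  constructor
  · intro hS F D h g₀ os
    exact (n17At_iff_betaOfRecord₁₃_params₁₃ h _).mp (hS F D h g₀ os 0)
  · intro hin F D h g₀ os k
    exact (n17At_iff_betaOfRecord₁₃_params₁₃ h _).mpr (hin F D h g₀ os)

/-- **THE ONE-APPLICATION CLOSER (∀θ estimate ⟹ the stub at the Stage-13 canonical home)**: the `βmTχ(θ)` rate `ScaleShiftRate (cr·C₅·θ₅) ρ θ.γ βmTχ(θ)` at the letters of
`(𝔯.lit F θ hP g₀ os).u3` for EVERY admissible Stage-13 tuple with provisos — the shape an estimate seat proves (NE4 = rows NE2 ∕ NE3 ∕ (D4) composed, NOT IN PRINT) — gives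
`S_N17 (RRec₁₃ 𝔯)` (instantiate at the canonical parameter of each datum key). [cite: Balaban1987RG1, (1.20)-(1.22) p.264] -/
theorem s_N17_rRec₁₃_of_forall_admissible
    (hin : ∀ (F : T4Family) (θ : Stage13Params F N) (hP : θ.Provisos₁₃ F N), θ.Admissible F N → ∀ (g₀ : ℕ → ℝ) (os : List (ULoop F)),
      letI := θ.instVβ₁; letI := θ.instVβ₂; letI := θ.instιβ
      ScaleShiftRate ((𝔯.lit F θ hP g₀ os).u3.cr * (𝔯.lit F θ hP g₀ os).u3.C₅ * (𝔯.lit F θ hP g₀ os).u3.θ₅) (𝔯.lit F θ hP g₀ os).u3.ρ θ.γ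
        (betaMerged F (mergedTermFamilyMatT F N (TcanOfRecord F N) (chiβOfRecord₁₃ F N θ) θ.εbg) θ.ρ8 θ.bV)) :
    S_N17 (RRec₁₃ 𝔯) :=
  (s_N17_rRec₁₃_iff_merged 𝔯).mpr fun F _ h g₀ os => hin F h.params h.provisos h.admissible g₀ os

/-- **THE SPLIT ROAD AT THE STAGE-13 CANONICAL HOME, IN MERGED CURRENCY** («β⁰ conv + β¹ shift» about `βmTχ(θ)` itself — companion 20 `N17_datumOfRecord₁₃_of_rates`, then
monotonicity in the constant): for every admissible tuple with provisos, every `g₀, os`, the letters `u := (𝔯.lit F θ hP g₀ os).u3` have `0 ≤ u.ρ ≤ 1` and there are constants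
`c₀ ≥ 0`, `c₁` with `2c₀ + c₁ ≤ u.cr·u.C₅·u.θ₅`, (AF-0r) `|beta0OfMerged βmTχ(θ) θ.v₀ k − β⁰_∞| ≤ c₀·u.ρ^k` (N15's currency) and `ScaleShiftRate c₁ u.ρ θ.γ (βmTχ(θ) − β⁰)` (N16 ∕ N18's)
⟹ `S_N17 (RRec₁₃ 𝔯)`.  Both binders UNPRINTED, displayed. [cite: Balaban1987RG1, (2.12)-(2.14) p.268] -/
theorem s_N17_rRec₁₃_of_split
    (hin : ∀ (F : T4Family) (θ : Stage13Params F N) (hP : θ.Provisos₁₃ F N), θ.Admissible F N → ∀ (g₀ : ℕ → ℝ) (os : List (ULoop F)),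
      letI := θ.instVβ₁; letI := θ.instVβ₂; letI := θ.instιβ
      0 ≤ (𝔯.lit F θ hP g₀ os).u3.ρ ∧ (𝔯.lit F θ hP g₀ os).u3.ρ ≤ 1 ∧
      ∃ (binf c₀ c₁ : ℝ), 0 ≤ c₀ ∧ 2 * c₀ + c₁ ≤ (𝔯.lit F θ hP g₀ os).u3.cr * (𝔯.lit F θ hP g₀ os).u3.C₅ * (𝔯.lit F θ hP g₀ os).u3.θ₅ ∧
        (∀ k, |beta0OfMerged (betaMerged F (mergedTermFamilyMatT F N (TcanOfRecord F N) (chiβOfRecord₁₃ F N θ) θ.εbg) θ.ρ8 θ.bV) θ.v₀ k - binf| ≤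
          c₀ * (𝔯.lit F θ hP g₀ os).u3.ρ ^ k) ∧
        ScaleShiftRate c₁ (𝔯.lit F θ hP g₀ os).u3.ρ θ.γ fun k w =>
          betaMerged F (mergedTermFamilyMatT F N (TcanOfRecord F N) (chiβOfRecord₁₃ F N θ) θ.εbg) θ.ρ8 θ.bV k w -
            beta0OfMerged (betaMerged F (mergedTermFamilyMatT F N (TcanOfRecord F N) (chiβOfRecord₁₃ F N θ) θ.εbg) θ.ρ8 θ.bV) θ.v₀ k) :
    S_N17 (RRec₁₃ 𝔯) := by
  rw [s_N17_rRec₁₃_iff]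
  intro F D h g₀ os k
  letI := h.params.instVβ₁; letI := h.params.instVβ₂; letI := h.params.instιβ
  obtain ⟨hρ0, hρ1, binf, c₀, c₁, hc₀, hcc, hconv, hrem⟩ := hin F h.params h.provisos h.admissible g₀ os
  have h17 := N17_datumOfRecord₁₃_of_rates h.params h.provisos le_rfl hρ0 hρ1 hc₀ hconv hrem
  rw [← h.eq_datumOfRecord₁₃, ne4OnData_iff] at h17
  rw [n17At_u3OfRecord₁₃_iff, ne4OnData_iff]
  exact scaleShiftRate_mono_const hcc hρ0 h17

/-- **THE U3 ROAD AT THE STAGE-13 CANONICAL HOME, BY NAME**: `S_D4 (RRec₁₃ 𝔯) → S_N18 (RRec₁₃ 𝔯) → S_N17 (RRec₁₃ 𝔯)` — `YMDAG.N17.s_N17_of_D4_N18` (record-generic) at the home (N22 idle);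
recorded so a K4 ∕ K3‴ composer at `RRec₁₃ 𝔯` can quote N17 as GLUE. [cite: Balaban1987RG1, (1.20)-(1.22) p.264] -/
theorem s_N17_rRec₁₃_of_s_D4_s_N18 (hD4 : S_D4 (RRec₁₃ 𝔯)) (h18 : S_N18 (RRec₁₃ 𝔯)) : S_N17 (RRec₁₃ 𝔯) :=
  YMDAG.N17.s_N17_of_D4_N18 (RRec₁₃ 𝔯) hD4 h18

/-- **THE U3 ROAD IN ∀θ FORM AT THE STAGE-13 BUNDLES OF RECORD**: the (D4) read-out binders at `(datumOfRecord₁₃ θ hP, u3OfRecord₁₃ θ (𝔯.lit F θ hP g₀ os).u3 k)` and NE5 at that bundle,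
for every admissible `θ` with provisos, every `g₀, os, k` ⟹ `S_N17 (RRec₁₃ 𝔯)` (pointwise `YMDAG.N17.n17At_of_readOutAt`, then layer B's `s_N17_rRec₁₃_iff` at the canonical parameters).
(D4) and NE5 UNPRINTED — binders. [cite: Balaban1987RG1, (1.20)-(1.22) p.264] -/
theorem s_N17_rRec₁₃_of_readOut_ne5_forall_admissible
    (hD4 : ∀ (F : T4Family) (θ : Stage13Params F N) (hP : θ.Provisos₁₃ F N), θ.Admissible F N → ∀ (g₀ : ℕ → ℝ) (os : List (ULoop F)) (k : ℕ),
      ReadOutAt (datumOfRecord₁₃ F N θ hP) (u3OfRecord₁₃ θ (𝔯.lit F θ hP g₀ os).u3 k))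
    (h18 : ∀ (F : T4Family) (θ : Stage13Params F N) (hP : θ.Provisos₁₃ F N), θ.Admissible F N → ∀ (g₀ : ℕ → ℝ) (os : List (ULoop F)) (k : ℕ),
      N18At (u3OfRecord₁₃ θ (𝔯.lit F θ hP g₀ os).u3 k)) :
    S_N17 (RRec₁₃ 𝔯) := by
  rw [s_N17_rRec₁₃_iff]
  intro F D h g₀ os k
  have h17 := YMDAG.N17.n17At_of_readOutAt _ (hD4 F h.params h.provisos h.admissible g₀ os k)
    (h18 F h.params h.provisos h.admissible g₀ os k)
  rwa [← h.eq_datumOfRecord₁₃] at h17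

/-- **WHAT THE STUB AT THE STAGE-13 CANONICAL HOME DELIVERS: (AF-0r) FOR THE ONE-LOOP NUMBERS OF RECORD AT EVERY DATUM KEY.**  `S_N17 (RRec₁₃ 𝔯)`, a Stage-13 datum of record `D`
with canonical parameter `θ := h.params`, `g₀, os` with letters `u := (𝔯.lit F θ h.provisos g₀ os).u3` satisfying `u.ρ < 1`, and `Beta0LimitExists βmTχ(θ) θ.v₀` at COHERENT reference
histories with entries in `]0, θ.γ]` ⟹ `∃ β⁰_∞, |beta0OfMerged βmTχ(θ) θ.v₀ k − β⁰_∞| ≤ (u.cr·u.C₅·u.θ₅ ∕ (1 − u.ρ))·u.ρ^k` (companion 21 `af0r_params₁₃_of_N17`).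
[cite: Balaban1987RG1, (2.12)-(2.14) p.268] -/
theorem af0r_of_s_N17_rRec₁₃ (hS : S_N17 (RRec₁₃ 𝔯)) {F : T4Family} {D : Datum F N} (h : IsDatumOfRecord₁₃C F N D) (g₀ : ℕ → ℝ)
    (os : List (ULoop F)) (hρ1 : (𝔯.lit F h.params h.provisos g₀ os).u3.ρ < 1)
    (hlim : letI := h.params.instVβ₁; letI := h.params.instVβ₂; letI := h.params.instιβ
      Beta0LimitExists (betaMerged F (mergedTermFamilyMatT F N (TcanOfRecord F N) (chiβOfRecord₁₃ F N h.params) h.params.εbg) h.params.ρ8 h.params.bV)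
        h.params.v₀)
    (hcoh : ∀ k, Fin.tail (h.params.v₀ (k + 1)) = h.params.v₀ k) (hadm : ∀ k i, 0 < h.params.v₀ k i ∧ h.params.v₀ k i ≤ h.params.γ) :
    letI := h.params.instVβ₁; letI := h.params.instVβ₂; letI := h.params.instιβ
    ∃ binf : ℝ, ∀ k,
      |beta0OfMerged (betaMerged F (mergedTermFamilyMatT F N (TcanOfRecord F N) (chiβOfRecord₁₃ F N h.params) h.params.εbg) h.params.ρ8 h.params.bV)
          h.params.v₀ k - binf| ≤
        (𝔯.lit F h.params h.provisos g₀ os).u3.cr * (𝔯.lit F h.params h.provisos g₀ os).u3.C₅ * (𝔯.lit F h.params h.provisos g₀ os).u3.θ₅ /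
          (1 - (𝔯.lit F h.params h.provisos g₀ os).u3.ρ) * (𝔯.lit F h.params h.provisos g₀ os).u3.ρ ^ k := by
  letI := h.params.instVβ₁; letI := h.params.instVβ₂; letI := h.params.instιβ
  exact af0r_params₁₃_of_N17 h le_rfl h.gamma_pos hρ1 hlim hcoh hadm
    ((n17At_u3OfRecord₁₃_iff D h.params _ 0).mp ((s_N17_rRec₁₃_iff 𝔯).mp hS F D h g₀ os 0))

/-! ## §70 THE STUB `S_N17 (RRec₁₃On 𝔯 Rg)` READ — the GUARDED ∀θ merged-β sentence AT THE TUPLE — ITS CLOSERS AND ITS DELIVERY -/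

/-- **THE K4 STUB `S_N17` AT THE REGIME-RESTRICTED STAGE-13 HOME IS THE GUARDED ∀θ SENTENCE ABOUT `βmTχ` OF THE TUPLE ITSELF**: `S_N17 (RRec₁₃On 𝔯 Rg)` ⟺ for every family, every
Stage-13 tuple `θ` with provisos `hP` IN THE REGIME and admissible, every `g₀, os`: `ScaleShiftRate (cr·C₅·θ₅) ρ θ.γ βmTχ(θ)` at the letters of `(𝔯.lit F θ hP g₀ os).u3` — layer B's
`s_N17_rRec₁₃On_iff` with the run length eliminated and the datum `datumOfRecord₁₃ F N θ hP` read through §69.  At the On home the stub IS the estimate seats' ∀θ currency verbatim.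
NE4 NOT IN PRINT; `𝔯` RESIDUAL. [cite: Balaban1987RG1, (1.20)-(1.22) p.264] -/
theorem s_N17_rRec₁₃On_iff_merged :
    S_N17 (RRec₁₃On 𝔯 Rg) ↔ ∀ (F : T4Family) (θ : Stage13Params F N) (hP : θ.Provisos₁₃ F N), Rg F θ → θ.Admissible F N →
      ∀ (g₀ : ℕ → ℝ) (os : List (ULoop F)),
      letI := θ.instVβ₁; letI := θ.instVβ₂; letI := θ.instιβ
      ScaleShiftRate ((𝔯.lit F θ hP g₀ os).u3.cr * (𝔯.lit F θ hP g₀ os).u3.C₅ * (𝔯.lit F θ hP g₀ os).u3.θ₅) (𝔯.lit F θ hP g₀ os).u3.ρ θ.γ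
        (betaMerged F (mergedTermFamilyMatT F N (TcanOfRecord F N) (chiβOfRecord₁₃ F N θ) θ.εbg) θ.ρ8 θ.bV) := by
  rw [s_N17_rRec₁₃On_iff]
  constructor
  · intro hS F θ hP hRg hθ g₀ os
    exact (n17At_u3OfRecord₁₃_datumOfRecord₁₃_iff θ hP _ 0).mp (hS F θ hP hRg hθ g₀ os 0)
  · intro hin F θ hP hRg hθ g₀ os k
    exact (n17At_u3OfRecord₁₃_datumOfRecord₁₃_iff θ hP _ k).mpr (hin F θ hP hRg hθ g₀ os)

/-- **… OR ABOUT def-T's β OF RECORD `betaOfRecord₁₃ θ` OF THE TUPLE** (`= (datumOfRecord₁₃ F N θ hP).βfun`, `rfl`; companion 20 `N17_datumOfRecord₁₃_iff_betaOfRecord₁₃`): the same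
guarded ∀θ sentence with no box bookkeeping. [cite: Balaban1987RG1, (1.20)-(1.22) p.264] -/
theorem s_N17_rRec₁₃On_iff_betaOfRecord₁₃ :
    S_N17 (RRec₁₃On 𝔯 Rg) ↔ ∀ (F : T4Family) (θ : Stage13Params F N) (hP : θ.Provisos₁₃ F N), Rg F θ → θ.Admissible F N →
      ∀ (g₀ : ℕ → ℝ) (os : List (ULoop F)),
      ScaleShiftRate ((𝔯.lit F θ hP g₀ os).u3.cr * (𝔯.lit F θ hP g₀ os).u3.C₅ * (𝔯.lit F θ hP g₀ os).u3.θ₅) (𝔯.lit F θ hP g₀ os).u3.ρ θ.γ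
        (betaOfRecord₁₃ F N θ) := by
  rw [s_N17_rRec₁₃On_iff]
  constructor
  · intro hS F θ hP hRg hθ g₀ os
    exact (N17_datumOfRecord₁₃_iff_betaOfRecord₁₃ θ hP _ _ _).mp ((n17At_u3OfRecord₁₃_iff _ θ _ 0).mp (hS F θ hP hRg hθ g₀ os 0))
  · intro hin F θ hP hRg hθ g₀ os k
    exact (n17At_u3OfRecord₁₃_iff _ θ _ k).mpr ((N17_datumOfRecord₁₃_iff_betaOfRecord₁₃ θ hP _ _ _).mpr (hin F θ hP hRg hθ g₀ os))

/-- **AT node00-def-RR-2's GUARD OF RECORD `Node00.unityNondeg₁₃ N`** (`= fun F θ => θ.ZtUnity F N ∧ θ.SlotsNondegenerate₁₃ F N`; the K3‴ items' bundle at `N = 2`): the stub IS «for every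
Stage-13 tuple with provisos, print's partition of unity AND non-degenerate present slots, admissible: the `βmTχ(θ)` rate at the reading's letters on `]0, θ.γ]`».
[cite: Balaban1987RG1, (1.20)-(1.22) p.264; Balaban1988Convergent, (3.16)-(3.22) pp.268-269] -/
theorem s_N17_rRec₁₃On_unityNondeg_iff_merged :
    S_N17 (RRec₁₃On 𝔯 (unityNondeg₁₃ N)) ↔ ∀ (F : T4Family) (θ : Stage13Params F N) (hP : θ.Provisos₁₃ F N),
      θ.ZtUnity F N ∧ θ.SlotsNondegenerate₁₃ F N → θ.Admissible F N → ∀ (g₀ : ℕ → ℝ) (os : List (ULoop F)),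
      letI := θ.instVβ₁; letI := θ.instVβ₂; letI := θ.instιβ
      ScaleShiftRate ((𝔯.lit F θ hP g₀ os).u3.cr * (𝔯.lit F θ hP g₀ os).u3.C₅ * (𝔯.lit F θ hP g₀ os).u3.θ₅) (𝔯.lit F θ hP g₀ os).u3.ρ θ.γ
        (betaMerged F (mergedTermFamilyMatT F N (TcanOfRecord F N) (chiβOfRecord₁₃ F N θ) θ.εbg) θ.ρ8 θ.bV) :=
  s_N17_rRec₁₃On_iff_merged 𝔯 _

/-- **THE ONE-APPLICATION CLOSER (guarded ∀θ estimate ⟹ the stub)**: the `βmTχ(θ)` rate at the reading's letters on `]0, θ.γ]` for every admissible tuple with provisos IN THE REGIME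
— the shape an estimate seat proves (NOT IN PRINT) — gives `S_N17 (RRec₁₃On 𝔯 Rg)`. [cite: Balaban1987RG1, (1.20)-(1.22) p.264] -/
theorem s_N17_rRec₁₃On_of_forall_guarded
    (hin : ∀ (F : T4Family) (θ : Stage13Params F N) (hP : θ.Provisos₁₃ F N), Rg F θ → θ.Admissible F N → ∀ (g₀ : ℕ → ℝ) (os : List (ULoop F)),
      letI := θ.instVβ₁; letI := θ.instVβ₂; letI := θ.instιβ
      ScaleShiftRate ((𝔯.lit F θ hP g₀ os).u3.cr * (𝔯.lit F θ hP g₀ os).u3.C₅ * (𝔯.lit F θ hP g₀ os).u3.θ₅) (𝔯.lit F θ hP g₀ os).u3.ρ θ.γ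
        (betaMerged F (mergedTermFamilyMatT F N (TcanOfRecord F N) (chiβOfRecord₁₃ F N θ) θ.εbg) θ.ρ8 θ.bV)) :
    S_N17 (RRec₁₃On 𝔯 Rg) :=
  (s_N17_rRec₁₃On_iff_merged 𝔯 Rg).mpr hin

/-- **THE SPLIT ROAD AT THE REGIME-RESTRICTED HOME, IN MERGED CURRENCY** (companion 20 `N17_datumOfRecord₁₃_of_rates` at the tuple's own datum, then monotonicity in the constant):
for every admissible tuple with provisos in the regime, every `g₀, os`, the letters `u := (𝔯.lit F θ hP g₀ os).u3` have `0 ≤ u.ρ ≤ 1` and there are `c₀ ≥ 0`, `c₁` with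
`2c₀ + c₁ ≤ u.cr·u.C₅·u.θ₅`, (AF-0r) `|beta0OfMerged βmTχ(θ) θ.v₀ k − β⁰_∞| ≤ c₀·u.ρ^k` (N15's currency) and `ScaleShiftRate c₁ u.ρ θ.γ (βmTχ(θ) − β⁰)` (N16 ∕ N18's) ⟹
`S_N17 (RRec₁₃On 𝔯 Rg)`.  Both binders UNPRINTED, displayed. [cite: Balaban1987RG1, (2.12)-(2.14) p.268] -/
theorem s_N17_rRec₁₃On_of_split
    (hin : ∀ (F : T4Family) (θ : Stage13Params F N) (hP : θ.Provisos₁₃ F N), Rg F θ → θ.Admissible F N → ∀ (g₀ : ℕ → ℝ) (os : List (ULoop F)),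
      letI := θ.instVβ₁; letI := θ.instVβ₂; letI := θ.instιβ
      0 ≤ (𝔯.lit F θ hP g₀ os).u3.ρ ∧ (𝔯.lit F θ hP g₀ os).u3.ρ ≤ 1 ∧
      ∃ (binf c₀ c₁ : ℝ), 0 ≤ c₀ ∧ 2 * c₀ + c₁ ≤ (𝔯.lit F θ hP g₀ os).u3.cr * (𝔯.lit F θ hP g₀ os).u3.C₅ * (𝔯.lit F θ hP g₀ os).u3.θ₅ ∧
        (∀ k, |beta0OfMerged (betaMerged F (mergedTermFamilyMatT F N (TcanOfRecord F N) (chiβOfRecord₁₃ F N θ) θ.εbg) θ.ρ8 θ.bV) θ.v₀ k - binf| ≤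
          c₀ * (𝔯.lit F θ hP g₀ os).u3.ρ ^ k) ∧
        ScaleShiftRate c₁ (𝔯.lit F θ hP g₀ os).u3.ρ θ.γ fun k w =>
          betaMerged F (mergedTermFamilyMatT F N (TcanOfRecord F N) (chiβOfRecord₁₃ F N θ) θ.εbg) θ.ρ8 θ.bV k w -
            beta0OfMerged (betaMerged F (mergedTermFamilyMatT F N (TcanOfRecord F N) (chiβOfRecord₁₃ F N θ) θ.εbg) θ.ρ8 θ.bV) θ.v₀ k) :
    S_N17 (RRec₁₃On 𝔯 Rg) := by
  rw [s_N17_rRec₁₃On_iff]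
  intro F θ hP hRg hθ g₀ os k
  letI := θ.instVβ₁; letI := θ.instVβ₂; letI := θ.instιβ
  obtain ⟨hρ0, hρ1, binf, c₀, c₁, hc₀, hcc, hconv, hrem⟩ := hin F θ hP hRg hθ g₀ os
  have h17 := N17_datumOfRecord₁₃_of_rates θ hP le_rfl hρ0 hρ1 hc₀ hconv hrem
  rw [ne4OnData_iff] at h17
  rw [n17At_u3OfRecord₁₃_iff, ne4OnData_iff]
  exact scaleShiftRate_mono_const hcc hρ0 h17

/-- **THE U3 ROAD AT THE REGIME-RESTRICTED HOME, BY NAME**: `S_D4 (RRec₁₃On 𝔯 Rg) → S_N18 (RRec₁₃On 𝔯 Rg) → S_N17 (RRec₁₃On 𝔯 Rg)` — `YMDAG.N17.s_N17_of_D4_N18` at the On home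
(N22 idle): a composer's `h17` from `hD4` and `h18` at the SAME regime. [cite: Balaban1987RG1, (1.20)-(1.22) p.264] -/
theorem s_N17_rRec₁₃On_of_s_D4_s_N18 (hD4 : S_D4 (RRec₁₃On 𝔯 Rg)) (h18 : S_N18 (RRec₁₃On 𝔯 Rg)) : S_N17 (RRec₁₃On 𝔯 Rg) :=
  YMDAG.N17.s_N17_of_D4_N18 (RRec₁₃On 𝔯 Rg) hD4 h18

/-- **THE U3 ROAD IN GUARDED ∀θ FORM**: the (D4) read-out binders at `(datumOfRecord₁₃ θ hP, u3OfRecord₁₃ θ (𝔯.lit F θ hP g₀ os).u3 k)` and NE5 at that bundle, for every admissible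
tuple with provisos in the regime, every `g₀, os, k` — the right-hand sides of layer B's `s_D4_rRec₁₃On_iff` ∕ `s_N18_rRec₁₃On_iff` — ⟹ `S_N17 (RRec₁₃On 𝔯 Rg)` (pointwise
`YMDAG.N17.n17At_of_readOutAt`).  (D4) and NE5 UNPRINTED — binders. [cite: Balaban1987RG1, (1.20)-(1.22) p.264] -/
theorem s_N17_rRec₁₃On_of_readOut_ne5_forall_guarded
    (hD4 : ∀ (F : T4Family) (θ : Stage13Params F N) (hP : θ.Provisos₁₃ F N), Rg F θ → θ.Admissible F N →
      ∀ (g₀ : ℕ → ℝ) (os : List (ULoop F)) (k : ℕ), ReadOutAt (datumOfRecord₁₃ F N θ hP) (u3OfRecord₁₃ θ (𝔯.lit F θ hP g₀ os).u3 k))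
    (h18 : ∀ (F : T4Family) (θ : Stage13Params F N) (hP : θ.Provisos₁₃ F N), Rg F θ → θ.Admissible F N →
      ∀ (g₀ : ℕ → ℝ) (os : List (ULoop F)) (k : ℕ), N18At (u3OfRecord₁₃ θ (𝔯.lit F θ hP g₀ os).u3 k)) :
    S_N17 (RRec₁₃On 𝔯 Rg) :=
  (s_N17_rRec₁₃On_iff 𝔯 Rg).mpr fun F θ hP hRg hθ g₀ os k =>
    YMDAG.N17.n17At_of_readOutAt _ (hD4 F θ hP hRg hθ g₀ os k) (h18 F θ hP hRg hθ g₀ os k)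

/-- **THE KERNEL ROAD IN GUARDED ∀θ FORM — N17 AT THE ON HOME END TO END IN KERNEL CURRENCY** (companion 20 `N17_datumOfRecord₁₃_of_kernelStepRate` on the record box of each tuple):
for every admissible tuple with provisos in the regime, every `g₀, os`, with letters `u := (𝔯.lit F θ hP g₀ os).u3`, `0 ≤ u.ρ < 1`: (UD) — (5.10)-decay of the record's OWN limiting
polarisation kernels of the `(TcanOfRecord, χβ₁₃)` family on the boxes `]0, θ.γ]` — ∧ their HISTORY-MATCHED STEP RATE at rate `C′·u.ρ^k`, with `betaPrime510 4 C′ δ′ ≤ u.cr·u.C₅·u.θ₅`,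
∧ `Beta0LimitExists βmTχ(θ) θ.v₀` at coherent admissible reference histories ⟹ `S_N17 (RRec₁₃On 𝔯 Rg)`.  (UD) PRINTED for Bałaban's kernels, a hypothesis here; the step rate NOT
PRINTED — rows NE2 ∕ NE3 ∕ NE5 in the record's letters. [cite: Balaban1987RG1, (1.21)-(1.22) p.264 and (5.10) p.293] -/
theorem s_N17_rRec₁₃On_of_kernelStepRate_forall_guarded
    (hin : ∀ (F : T4Family) (θ : Stage13Params F N) (hP : θ.Provisos₁₃ F N), Rg F θ → θ.Admissible F N → ∀ (g₀ : ℕ → ℝ) (os : List (ULoop F)),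
      letI := θ.instVβ₁; letI := θ.instVβ₂; letI := θ.instιβ
      0 ≤ (𝔯.lit F θ hP g₀ os).u3.ρ ∧ (𝔯.lit F θ hP g₀ os).u3.ρ < 1 ∧
      ∃ (C δ C' δ' : ℝ), 0 < δ ∧ 0 < δ' ∧
        betaPrime510 4 C' δ' ≤ (𝔯.lit F θ hP g₀ os).u3.cr * (𝔯.lit F θ hP g₀ os).u3.C₅ * (𝔯.lit F θ hP g₀ os).u3.θ₅ ∧
        (∀ k (v : Fin (k + 1) → ℝ), v ∈ Box θ.γ k →
          Decay510 (polLimit F (k + 1)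
            (fun K => mergedTermFamilyMatT F N (TcanOfRecord F N) (chiβOfRecord₁₃ F N θ) θ.εbg k v K) θ.ρ8 θ.bV 0 1) C δ) ∧
        (∀ k (w : Fin (k + 2) → ℝ), w ∈ Box θ.γ (k + 1) →
          Decay510 (subKernel
            (polLimit F (k + 1 + 1) (fun K => mergedTermFamilyMatT F N (TcanOfRecord F N) (chiβOfRecord₁₃ F N θ) θ.εbg (k + 1) w K) θ.ρ8 θ.bV)
            (polLimit F (k + 1) (fun K => mergedTermFamilyMatT F N (TcanOfRecord F N) (chiβOfRecord₁₃ F N θ) θ.εbg k (Fin.tail w) K) θ.ρ8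
              θ.bV) 0 1) (C' * (𝔯.lit F θ hP g₀ os).u3.ρ ^ k) δ') ∧
        Beta0LimitExists (betaMerged F (mergedTermFamilyMatT F N (TcanOfRecord F N) (chiβOfRecord₁₃ F N θ) θ.εbg) θ.ρ8 θ.bV) θ.v₀ ∧
        (∀ k, Fin.tail (θ.v₀ (k + 1)) = θ.v₀ k) ∧ (∀ k i, 0 < θ.v₀ k i ∧ θ.v₀ k i ≤ θ.γ)) :
    S_N17 (RRec₁₃On 𝔯 Rg) := by
  rw [s_N17_rRec₁₃On_iff]
  intro F θ hP hRg hθ g₀ os k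
  letI := θ.instVβ₁; letI := θ.instVβ₂; letI := θ.instιβ
  obtain ⟨hρ0, hρ1, C, δ, C', δ', hδ, hδ', hcc, hU, hS, hlim, hcoh, hadm⟩ := hin F θ hP hRg hθ g₀ os
  have h17 := (N17_datumOfRecord₁₃_of_kernelStepRate θ hP le_rfl hθ.toStage9.gamma_pos hρ0 hρ1 hδ hδ' hU hS hlim hcoh hadm).1
  rw [ne4OnData_iff] at h17
  rw [n17At_u3OfRecord₁₃_iff, ne4OnData_iff]
  exact scaleShiftRate_mono_const hcc hρ0 h17

/-- **WHAT THE STUB AT THE ON HOME DELIVERS AT EACH GUARDED TUPLE — ABOUT THE TUPLE's OWN ONE-LOOP NUMBERS** (the converse bookkeeping of the split road; companion 20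
`content_of_N17_datumOfRecord₁₃` on the record box): `S_N17 (RRec₁₃On 𝔯 Rg)`, an admissible tuple `θ` with provisos in the regime, `g₀, os` with letters `u := (𝔯.lit F θ hP g₀ os).u3`,
`0 ≤ u.ρ < 1`, `Beta0LimitExists βmTχ(θ) θ.v₀` at COHERENT reference histories with entries in `]0, θ.γ]` ⟹ (AF-0r) `∃ β⁰_∞, |beta0OfMerged βmTχ(θ) θ.v₀ k − β⁰_∞| ≤
(u.cr·u.C₅·u.θ₅ ∕ (1 − u.ρ))·u.ρ^k` AND the merged remainder's scale-shift rate with constant `c + 2c∕(1 − ρ)` — N15 ∕ N16-type outputs RETURNED by the composite, constants degraded by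
`1∕(1 − ρ)`. [cite: Balaban1987RG1, (2.12)-(2.14) p.268] -/
theorem af0r_of_s_N17_rRec₁₃On (hS : S_N17 (RRec₁₃On 𝔯 Rg)) {F : T4Family} (θ : Stage13Params F N) (hP : θ.Provisos₁₃ F N) (hRg : Rg F θ)
    (hθ : θ.Admissible F N) (g₀ : ℕ → ℝ) (os : List (ULoop F)) (hρ0 : 0 ≤ (𝔯.lit F θ hP g₀ os).u3.ρ) (hρ1 : (𝔯.lit F θ hP g₀ os).u3.ρ < 1)
    (hlim : letI := θ.instVβ₁; letI := θ.instVβ₂; letI := θ.instιβ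
      Beta0LimitExists (betaMerged F (mergedTermFamilyMatT F N (TcanOfRecord F N) (chiβOfRecord₁₃ F N θ) θ.εbg) θ.ρ8 θ.bV) θ.v₀)
    (hcoh : ∀ k, Fin.tail (θ.v₀ (k + 1)) = θ.v₀ k) (hadm : ∀ k i, 0 < θ.v₀ k i ∧ θ.v₀ k i ≤ θ.γ) :
    letI := θ.instVβ₁; letI := θ.instVβ₂; letI := θ.instιβ
    (∃ binf : ℝ, ∀ k,
        |beta0OfMerged (betaMerged F (mergedTermFamilyMatT F N (TcanOfRecord F N) (chiβOfRecord₁₃ F N θ) θ.εbg) θ.ρ8 θ.bV) θ.v₀ k - binf| ≤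
          (𝔯.lit F θ hP g₀ os).u3.cr * (𝔯.lit F θ hP g₀ os).u3.C₅ * (𝔯.lit F θ hP g₀ os).u3.θ₅ / (1 - (𝔯.lit F θ hP g₀ os).u3.ρ) *
            (𝔯.lit F θ hP g₀ os).u3.ρ ^ k) ∧
      ScaleShiftRate
        ((𝔯.lit F θ hP g₀ os).u3.cr * (𝔯.lit F θ hP g₀ os).u3.C₅ * (𝔯.lit F θ hP g₀ os).u3.θ₅ +
          2 * ((𝔯.lit F θ hP g₀ os).u3.cr * (𝔯.lit F θ hP g₀ os).u3.C₅ * (𝔯.lit F θ hP g₀ os).u3.θ₅ / (1 - (𝔯.lit F θ hP g₀ os).u3.ρ)))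
        (𝔯.lit F θ hP g₀ os).u3.ρ θ.γ (fun k w =>
        betaMerged F (mergedTermFamilyMatT F N (TcanOfRecord F N) (chiβOfRecord₁₃ F N θ) θ.εbg) θ.ρ8 θ.bV k w -
          beta0OfMerged (betaMerged F (mergedTermFamilyMatT F N (TcanOfRecord F N) (chiβOfRecord₁₃ F N θ) θ.εbg) θ.ρ8 θ.bV) θ.v₀ k) := by
  letI := θ.instVβ₁; letI := θ.instVβ₂; letI := θ.instιβ
  exact content_of_N17_datumOfRecord₁₃ θ hP le_rfl hθ.toStage9.gamma_pos hρ0 hρ1 hlim hcoh hadm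
    ((n17At_u3OfRecord₁₃_iff _ θ _ 0).mp ((s_N17_rRec₁₃On_iff 𝔯 Rg).mp hS F θ hP hRg hθ g₀ os 0))

/-! ## §71 TRANSFERS: antitone in the regime · to the canonical home · unity ⟹ guard of record · the vacuity face -/

/-- **ANTITONE IN THE REGIME** (single-node cut of layer B's `k4_rRec₁₃On_anti`): proved over a larger regime, the stub holds over every smaller one. [bookkeeping]
[cite: Balaban1987RG1, (1.20)-(1.22) p.264] -/
theorem s_N17_rRec₁₃On_anti {Rg Rg' : (F : T4Family) → Stage13Params F N → Prop} (h : ∀ F θ, Rg F θ → Rg' F θ) (hS : S_N17 (RRec₁₃On 𝔯 Rg')) :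
    S_N17 (RRec₁₃On 𝔯 Rg) :=
  (k4_rRec₁₃On_anti 𝔯 h).2.2.2.1 hS

/-- **THE ON HOME AT THE TRIVIAL REGIME GIVES THE CANONICAL HOME `RRec₁₃ 𝔯`** (single-node cut of layer B's `k4_rRec₁₃_of_rRec₁₃On_true`).  The converse is NOT claimed (N17 reads the
tuple's `θ.γ` and the letters at the tuple). [bookkeeping] [cite: Balaban1987RG1, (1.20)-(1.22) p.264] -/
theorem s_N17_rRec₁₃_of_rRec₁₃On_true (hS : S_N17 (RRec₁₃On 𝔯 fun _ _ => True)) : S_N17 (RRec₁₃ 𝔯) :=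
  (k4_rRec₁₃_of_rRec₁₃On_true 𝔯).2.2.2.1 hS

/-- … and the On home at any regime. [bookkeeping] [cite: Balaban1987RG1, (1.20)-(1.22) p.264] -/
theorem s_N17_rRec₁₃On_of_rRec₁₃On_true (hS : S_N17 (RRec₁₃On 𝔯 fun _ _ => True)) : S_N17 (RRec₁₃On 𝔯 Rg) :=
  s_N17_rRec₁₃On_anti 𝔯 (fun _ _ _ => trivial) hS

/-- **THE ON HOME AT A REGIME CONTAINING EVERY CANONICAL PARAMETER GIVES THE CANONICAL HOME** (layer B's `rRec₁₃On_of_regime_params`). [bookkeeping]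
[cite: Balaban1987RG1, (1.20)-(1.22) p.264] -/
theorem s_N17_rRec₁₃_of_rRec₁₃On_of_regime_params (hreg : ∀ (F : T4Family) (D : Datum F N) (h : IsDatumOfRecord₁₃C F N D), Rg F h.params)
    (hS : S_N17 (RRec₁₃On 𝔯 Rg)) : S_N17 (RRec₁₃ 𝔯) :=
  fun F D g₀ os R hR => hS F D g₀ os R (rRec₁₃On_of_regime_params 𝔯 Rg hreg hR)

/-- **THE UNITY REGIME GIVES THE GUARD OF RECORD** (print's partition-of-unity class ⊇ RR-2's `unityNondeg₁₃ N`): `S_N17` over `θ.ZtUnity F N` alone ⟹ the stub at the guard of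
record. [bookkeeping] [cite: Balaban1987RG1, (1.20)-(1.22) p.264] -/
theorem s_N17_rRec₁₃On_unityNondeg_of_ztUnity (hS : S_N17 (RRec₁₃On 𝔯 fun F θ => θ.ZtUnity F N)) : S_N17 (RRec₁₃On 𝔯 (unityNondeg₁₃ N)) :=
  s_N17_rRec₁₃On_anti 𝔯 (fun F θ h => ((unityNondeg₁₃_iff F N θ).mp h).1) hS

/-- **THE VACUITY FACE (R422 honesty)**: if NO family has an admissible Stage-13 tuple with provisos in the regime — the `Rg`-shadow of K0‴ `Record13Inhabited` failing — the stub at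
the On home holds vacuously.  Recorded so that a landing of `S_N17 (RRec₁₃On 𝔯 Rg)` is read together with the regime's inhabitation. [bookkeeping] [cite: Balaban1987RG1, (1.20)-(1.22) p.264] -/
theorem s_N17_rRec₁₃On_of_guard_empty (hempty : ∀ (F : T4Family) (θ : Stage13Params F N), θ.Provisos₁₃ F N → Rg F θ → ¬ θ.Admissible F N) :
    S_N17 (RRec₁₃On 𝔯 Rg) :=
  (s_N17_rRec₁₃On_iff 𝔯 Rg).mpr fun F θ hP hRg hθ => absurd hθ (hempty F θ hP hRg)

end Summit.QuantumFields.YangMills.Theorems.BalabanUVNodesN17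

end
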